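import Mathlib.NumberTheory.LSeries.Basic
import Mathlib.Analysis.SpecialFunctions.Gamma.Basic
import Mathlib.Analysis.MellinTransform
import Literature.NumberTheory.LFunctions.DobnerNewman
import Literature.Analysis.Complex.DeBruijnUniversalFactors
import HarnessLib

/-!
# Dobner's generalized de Bruijn–Newman constant `Λ_F` for the extended Selberg class `𝒮♯`
(arXiv:2005.05142 §2, as printed; named facts)

RH-FREE literature typing. Trunk T-ANT (`Literature/NumberTheory/LFunctions`), companion of
`DobnerNewman.lean` (the `F = ζ` case) and `SelbergClass.lean` (Selberg's class `𝒮`).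

> A. Dobner, *A proof of Newman's conjecture for the extended Selberg class*, Acta Arith. **201**
> (2021), 29–62 = arXiv:2005.05142. Source of record: the held arXiv text (18 pp.); theorem and
> lemma NUMBERS are the arXiv numbers (= Acta Arith. numbering), PAGES are the PDF pages of the
> held text: Thm. 1 / Thm. 2 p. 3; §2 (definition of `𝒮♯`, `γ`, `ξ^F`, `Φ_F`, `ξ^F_t`, Lemma 1)
> p. 5; Thm. 3 (de Bruijn), proof of Thm. 1 (`H_t`, `𝒵`, `Λ_F`), Lemma 2 pp. 6–7; §5 (proofs of
> Lemmas 1–2) pp. 15–16.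

## What is typed here (section §2 of the source, in `𝒮♯`-generality)

* `Literature.NumberTheory.LFunctions.dobnerGamma α m Q ω μ` — the gamma factor
  `γ(s) = α sᵐ (s−1)ᵐ Qˢ ∏ᵢ Γ(ωᵢ s + μᵢ)` of condition (iii) (p. 5);
* `Literature.NumberTheory.LFunctions.ExtendedSelbergDatum` — a member `F` of the **extended
  Selberg class `𝒮♯`** (Kaczorowski–Perelli 1999) in Dobner's normalisation, i.e. the data
  `(aₙ, F, m, α, Q, k, ωᵢ, μᵢ)` with conditions (i) Dirichlet series, (ii) meromorphic continuation
  of finite order, (iii) functional equation `ξ^F(s) = conj ξ^F(1 − conj s)` for `ξ^F = γ F`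
  (p. 5), and `Literature.NumberTheory.LFunctions.IsInExtendedSelbergClass F := ∃ D, D.toFun = F`;
* for a datum `D`: `D.gamma`, `D.xi` (`ξ^F`), `D.Phi` (`Φ_F`, eq. for `Φ_F` p. 5), `D.Ht`
  (`H_t(z) = ξ^F_t((1+iz)/2) = ∫ e^{tu²} Φ_F(u) e^{izu} du`, p. 5 / p. 6, via the tree's
  `Literature.Analysis.Complex.trigIntegral`), `D.xiDeformed` (`ξ^F_t`), `D.realZeroTimes` (`𝒵`,
  p. 6, via the tree's `Literature.NumberTheory.LFunctions.HasOnlyRealZeros`), `D.dbnConst`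
  (`Λ_F = inf 𝒵`, p. 7);
* NAMED FACTS (D-0014; nothing asserted, users take `(h : <name>)`):
  `Literature.NumberTheory.LFunctions.dobner_theorem1` (**Thm. 1**: existence of `Λ_F`),
  `Literature.NumberTheory.LFunctions.dobner_theorem2` (**Thm. 2**: `Λ_F ≥ 0`, typed in the
  `sInf`-free form "for every `t < 0`, `ξ^F_t` has a zero off the critical line" which is what §3
  proves — its `F = ζ` case is the tree THEOREM
  `Literature.NumberTheory.LFunctions.rodgers_tao_holds`),
  `Literature.NumberTheory.LFunctions.dobner_lemma1` (**Lemma 1**: Stirling-type two-sided bound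
  for `γ`), `Literature.NumberTheory.LFunctions.dobner_lemma2` (**Lemma 2**: decay of the inverse
  Mellin transform of `∏ Γ(aⱼ w + bⱼ)`, via Mathlib's `mellinInv`);
* PROVED: the literal forms `HasOnlyRealZeros (H_t) ↔ Λ_F ≤ t` and `0 ≤ Λ_F` from the two facts,
  `𝒵` in terms of `ξ^F_t` (zeros on the critical line), the consequence `aₙ = O(n²)` of (i)
  (p. 5), and Dobner's remark that for `F = ζ` one may take
  `γ(s) = ½ s(s−1) π^{-s/2} Γ(s/2)` (`= Literature.NumberTheory.LFunctions.xiGammaFactor`).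

## What is CITED, not restated

* **Thm. 3** (p. 6) = de Bruijn 1950, Thm. 13 for a general kernel `φ` (integrable,
  `φ(u) = conj φ(−u)`, `φ = O(e^{−|u|^b})`, `b > 2`): this is EXACTLY the tree's named fact
  `Literature.Analysis.Complex.DeBruijn1950.thm13` (kernel hypotheses =
  `Literature.Analysis.Complex.DeBruijn1950.IsAdmissible`, conclusion via
  `Literature.Analysis.Complex.RootsInStrip`), DISCHARGED as
  `Literature.Analysis.Complex.DeBruijn1950.thm13_holds` (`DeBruijnUniversalFactorsThm13.lean`);
  Dobner's parametrisation `e^{tu²}`, `t > 0`, strip `√max(Δ² − 2t, 0)` is de Bruijn's with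
  `λ² = 2t`. No declaration here.
* The `F = ζ` objects and results (Thm. 4, Thm. 5 = Bohr, Lemma 3, Lemmas 4–7, and Thm. 2 for
  `ζ`): `DobnerNewman.lean`, `DobnerSteepestDescent.lean`, `DobnerLemma4Tools.lean` and their
  `…Proofs` files (`rodgers_tao_of_dobner`, `dobner_lemma4_holds`, `rodgers_tao_holds`).
* Selberg's class `𝒮` (`Literature.NumberTheory.LFunctions.SelbergDatum`, `IsInSelbergClass`):
  `𝒮♯` drops the Ramanujan and Euler product axioms and puts `sᵐ(s−1)ᵐ` and `α ≠ 0` into `γ`;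
  `SelbergDatum` does not factor through an `𝒮♯`-structure, hence the separate structure below
  (the inclusion `𝒮 ⊆ 𝒮♯` and `ζ ∈ 𝒮♯` are left to the Proofs file).

## Rendering choices / divergences from the printed text (for the referee)

1. (Pointwise conventions, as in `SelbergClass.lean`.) Mathlib functions are total, so (ii) is
   phrased with an entire `G` agreeing with `(s−1)ᵐ F(s)` for `s ≠ 1`, and the clause "`m` is the
   order of the pole of `F` at `s = 1` (or `m = 0` if there is no pole)" of (iii) becomes
   `0 < m → G 1 ≠ 0`; the functional equation is required on the open critical strip
   `0 < Re s < 1` only, where `γ` is pole-free (`Re(ωᵢ s + μᵢ) > 0`) and `F` is holomorphic — by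
   the identity theorem this is equivalent to the printed identity of entire functions. `D.xi` is
   the pointwise product `γ(s) F(s)`: it is the printed entire `ξ^F` off `s = 1` and off the poles
   of `γ`, in particular on the critical line, which is the only place `Φ_F` uses it.
2. `Λ_F` is attached to the DATUM (`F` together with the chosen `γ`); Dobner's remark that `γ` is
   unique up to a real scalar (Conrey–Ghosh 1993), so that `Λ_F` depends on `F` only (p. 5), is
   not typed.
3. Hypothesis `0 < k` (at least one `Γ`-factor) is carried EXPLICITLY by Thm. 1, Thm. 2, Lemma 1,
   Lemma 2: the printed conditions (i)–(iii) admit `k = 0` (e.g. `F = 1` with `γ = Qˢ`, `Q = 1`,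
   `α` real), for which `ξ^F` does not decay on vertical lines, `Φ_F` is not a function and the
   printed Lemma 1 / Thm. 1 fail; the source uses `k ≥ 1` tacitly (Lemma 1, "each `Γ` factor").
4. Lemma 1 is typed in the large-`|Im s|` form its proof establishes (p. 15: "We may assume
   `|Im s|` is large, because the small `|Im s|` case follows by compactness"): the printed
   two-sided bound `exp(−K'|Im s|) ≤ |γ(s)| ≤ exp(−K|Im s|)` for ALL `s` at unit distance from the
   poles of `γ`, with no implied constants, is false for bounded `Im s` (e.g. `γ(1) = 0` when
   `m ≥ 1`; `|γ(10)| > 1` for `F = ζ`), and compactness only gives it up to constant factors.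
5. Thm. 2 is typed `sInf`-free, as the first sentence of §3 (p. 8) states the content proved:
   "for every `t < 0` the function `ξ^F_t` has zeros off the critical line"; the literal
   `Λ_F ≥ 0` is then the theorem `ExtendedSelbergDatum.dbnConst_nonneg` (from Thm. 1 + Thm. 2),
   exactly as `rodgers_tao` / `deBruijnNewmanConst_nonneg` are organised in `Equivalents.lean`.
6. Bochner-integral junk values: `Φ_F`, `H_t` are `0` where the integrals diverge; Thm. 1's proof
   (pp. 6–7) shows they converge for every datum with `k ≥ 1` (Lemma 1 + Phragmén–Lindelöf, and
   Lemma 2), which is part of the content of the named fact `dobner_theorem1`.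

Deliberately NOT here: the `𝒮♯`-generality of Thm. 4 (`F_t`, `J_t`, `γ_t` with general
`Q, ωᵢ`) and of Lemmas 3–7; the Phragmén–Lindelöf bound for `F` in vertical strips (p. 5,
unnumbered); uniqueness of `γ`; discharges (→ `DobnerSelbergClassProofs.lean`).

bears_on: N-C/N-P (COLUMN 3 DBN). WHAT THIS IS NOT: nothing in this file bears on the truth of
RH (or of GRH for `𝒮♯`); `Λ_ζ ≥ 0` is already the kernel theorem `rodgers_tao_holds`.

## References

* A. Dobner, *A proof of Newman's conjecture for the extended Selberg class*, Acta Arith. 201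
  (2021), 29–62; arXiv:2005.05142: Thms. 1–2 (p. 3), §2 (pp. 5–7), §5 (pp. 15–16).
* J. Kaczorowski, A. Perelli, Acta Math. 182 (1999), 207–241 (the class `𝒮♯`); N. G. de Bruijn,
  Duke Math. J. 17 (1950), Thm. 13; J. B. Conrey, A. Ghosh, Duke Math. J. 72 (1993).
-/

noncomputable section

open Complex Filter Set Asymptotics MeasureTheory
open scoped ComplexConjugate

namespace Literature.NumberTheory.LFunctions

/-! ## The gamma factor `γ` of condition (iii) -/

/-- Dobner's gamma factor `γ(s) = α sᵐ (s − 1)ᵐ Qˢ ∏_{i=1}^{k} Γ(ωᵢ s + μᵢ)` of condition (iii)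
of the extended Selberg class (parameters `α ∈ ℂ ∖ {0}`, `Q > 0`, `ωᵢ > 0`, `Re μᵢ ≥ 0`,
`m ∈ ℕ`; the positivity constraints are hypotheses of the statements, not of this definition).
`Qˢ` is the principal complex power of the real number `Q`. [cite: Dobner2021, §2 (iii), p. 5] -/
def dobnerGamma (α : ℂ) (m : ℕ) (Q : ℝ) {k : ℕ} (ω : Fin k → ℝ) (μ : Fin k → ℂ) (s : ℂ) : ℂ :=
  α * s ^ m * (s - 1) ^ m * (Q : ℂ) ^ s * ∏ i, Complex.Gamma ((ω i : ℂ) * s + μ i)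

/-- Unfolding lemma for `dobnerGamma` (the displayed formula for `γ`, p. 5). [cite: Dobner2021, §2 (iii), p. 5] -/
theorem dobnerGamma_apply (α : ℂ) (m : ℕ) (Q : ℝ) {k : ℕ} (ω : Fin k → ℝ) (μ : Fin k → ℂ)
    (s : ℂ) : dobnerGamma α m Q ω μ s =
      α * s ^ m * (s - 1) ^ m * (Q : ℂ) ^ s * ∏ i, Complex.Gamma ((ω i : ℂ) * s + μ i) := rfl

/-- Dobner's remark (p. 5): "if `F` is the Riemann zeta function, then one may choose
`γ(s) = ½ s(s−1) π^{−s/2} Γ(s/2)` to make `ξ^F` the usual Riemann xi function" — i.e. with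
`α = ½`, `m = 1`, `Q = π^{−1/2}`, `k = 1`, `ω₁ = ½`, `μ₁ = 0` the factor `dobnerGamma` is the
tree's `xiGammaFactor s = ½ s(s−1) Γ_ℝ(s)`. [cite: Dobner2021, §2 p. 5] -/
theorem dobnerGamma_zeta (s : ℂ) :
    dobnerGamma (1 / 2) 1 (Real.pi ^ (-(1 / 2 : ℝ))) (fun _ : Fin 1 ↦ 1 / 2) (fun _ ↦ 0) s =
      xiGammaFactor s := by
  rw [dobnerGamma_apply, xiGammaFactor, Gammaℝ_def, Fin.prod_univ_one]
  have hπ : (0 : ℝ) < Real.pi := Real.pi_pos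
  have hQ : (0 : ℝ) < Real.pi ^ (-(1 / 2 : ℝ)) := Real.rpow_pos_of_pos hπ _
  have hpow : ((Real.pi ^ (-(1 / 2 : ℝ)) : ℝ) : ℂ) ^ s = (Real.pi : ℂ) ^ (-s / 2) := by
    rw [Complex.cpow_def_of_ne_zero (by exact_mod_cast hQ.ne'),
      Complex.cpow_def_of_ne_zero (by exact_mod_cast hπ.ne'),
      ← Complex.ofReal_log hQ.le, Real.log_rpow hπ, ← Complex.ofReal_log hπ.le]
    congr 1
    push_cast
    ring
  rw [hpow]
  push_cast
  ring_nf

/-! ## The extended Selberg class `𝒮♯` (Dobner's normalisation) -/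

/-- A member `F` of the **extended Selberg class `𝒮♯`** (Kaczorowski–Perelli 1999) together with
a choice of the data of Dobner's conditions (i)–(iii) (arXiv:2005.05142, §2, p. 5): "`F(s)` is said
to be a member of `𝒮♯` if it is not identically zero and (i) `F(s) = ∑ aₙ n⁻ˢ` converges
absolutely for `Re s > 1`; (ii) `(s−1)ᵐ F(s)` is an entire function of finite order for some
nonnegative integer `m`; (iii) let `m` be the order of the pole of `F` at `s = 1` (or `m = 0` if
`F` has no pole); there is `γ(s) = α sᵐ (s−1)ᵐ Qˢ ∏_{i=1}^{k} Γ(ωᵢ s + μᵢ)` with `α ≠ 0`, `Q > 0`,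
`ωᵢ > 0`, `Re μᵢ ≥ 0` such that `ξ^F(s) := γ(s) F(s)` satisfies `ξ^F(s) = conj ξ^F(1 − conj s)`."
Pointwise conventions (module docstring, item 1): continuation via an entire `G` agreeing with
`(s−1)ᵐ F(s)` off `s = 1`, "`m` = order of the pole" as `0 < m → G 1 ≠ 0`, functional equation on
the open critical strip. No normalisation `a₁ = 1`, no Ramanujan bound, no Euler product
(contrast `SelbergDatum`). [cite: Dobner2021, §2 (i)–(iii), p. 5] -/
structure ExtendedSelbergDatum where
  /-- The Dirichlet coefficients `aₙ` (the value at `0` is irrelevant: `LSeries` ignores it). -/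
  coeff : ℕ → ℂ
  /-- The function `F : ℂ → ℂ` (its continuation; the value at the possible pole `s = 1` is
  unconstrained). -/
  toFun : ℂ → ℂ
  /-- The order `m` of the pole of `F` at `s = 1` (`m = 0`: no pole). -/
  polarOrder : ℕ
  /-- The constant `α ≠ 0` of `γ`. -/
  alpha : ℂ
  /-- The parameter `Q > 0` of `γ`. -/
  Q : ℝ
  /-- The number `k` of `Γ`-factors. -/
  numGamma : ℕ
  /-- The parameters `ωᵢ > 0` of the factors `Γ(ωᵢ s + μᵢ)`. -/
  omega : Fin numGamma → ℝ
  /-- The parameters `μᵢ`, `Re μᵢ ≥ 0`, of the factors `Γ(ωᵢ s + μᵢ)`. -/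
  mu : Fin numGamma → ℂ
  /-- `F` is not identically zero (off the unconstrained value at `s = 1`). -/
  exists_ne_zero : ∃ s : ℂ, s ≠ 1 ∧ toFun s ≠ 0
  /-- (i) the Dirichlet series `∑ aₙ n⁻ˢ` converges absolutely for `Re s > 1` … -/
  summable : ∀ s : ℂ, 1 < s.re → LSeriesSummable coeff s
  /-- … and represents `F` there. -/
  eqOn_LSeries : Set.EqOn toFun (LSeries coeff) {s | 1 < s.re}
  /-- (ii) `(s−1)ᵐ F(s)` extends to an entire function `G`, and `m` is exactly the order of the
  pole at `s = 1` (`G(1) ≠ 0` when `m > 0`). -/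
  differentiable : ∃ G : ℂ → ℂ, Differentiable ℂ G ∧
    (∀ s, s ≠ 1 → G s = (s - 1) ^ polarOrder * toFun s) ∧ (0 < polarOrder → G 1 ≠ 0)
  /-- (ii) finite order: `‖(s−1)ᵐ F(s)‖ ≤ A exp(‖s‖^B)` for `s ≠ 1`. -/
  finiteOrder : ∃ A B : ℝ, ∀ s, s ≠ 1 →
    ‖(s - 1) ^ polarOrder * toFun s‖ ≤ A * Real.exp (‖s‖ ^ B)
  /-- `α ≠ 0`. -/
  alpha_ne_zero : alpha ≠ 0
  /-- `Q > 0`. -/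
  Q_pos : 0 < Q
  /-- `ωᵢ > 0`. -/
  omega_pos : ∀ i, 0 < omega i
  /-- `Re μᵢ ≥ 0`. -/
  mu_re_nonneg : ∀ i, 0 ≤ (mu i).re
  /-- (iii) the functional equation `ξ^F(s) = conj (ξ^F(1 − conj s))`, `ξ^F = γ F`, on the open
  critical strip. -/
  functional_equation : ∀ s : ℂ, 0 < s.re → s.re < 1 →
    dobnerGamma alpha polarOrder Q omega mu s * toFun s =
      conj (dobnerGamma alpha polarOrder Q omega mu (1 - conj s) * toFun (1 - conj s))

/-- Membership in the extended Selberg class `𝒮♯`: `F : ℂ → ℂ` underlies some extended Selberg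
datum (Dobner, §2, p. 5; Kaczorowski–Perelli 1999). [cite: Dobner2021, §2 p. 5] -/
def IsInExtendedSelbergClass (F : ℂ → ℂ) : Prop :=
  ∃ D : ExtendedSelbergDatum, D.toFun = F

namespace ExtendedSelbergDatum

variable (D : ExtendedSelbergDatum)

/-- The gamma factor `γ(s) = α sᵐ (s−1)ᵐ Qˢ ∏ Γ(ωᵢ s + μᵢ)` of the datum. [cite: Dobner2021, §2 (iii), p. 5] -/
def gamma (s : ℂ) : ℂ :=
  dobnerGamma D.alpha D.polarOrder D.Q D.omega D.mu s

/-- The completed function `ξ^F(s) = γ(s) F(s)` of the datum, as a pointwise product (it is the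
printed entire function off `s = 1` and off the poles of `γ`, in particular on the critical line
and on `{Re s > 0} ∖ {1}`). [cite: Dobner2021, §2 (iii), p. 5] -/
def xi (s : ℂ) : ℂ :=
  D.gamma s * D.toFun s

/-- Unfolding of `ξ^F = γ F` (p. 5). [cite: Dobner2021, §2 (iii), p. 5] -/
theorem xi_apply (s : ℂ) : D.xi s = D.gamma s * D.toFun s := rfl

/-- The functional equation `ξ^F(s) = conj (ξ^F(1 − conj s))` on the open critical strip, in terms
of `D.xi` (condition (iii)). [cite: Dobner2021, §2 (iii), p. 5] -/
theorem xi_eq_conj_xi (s : ℂ) (hs₀ : 0 < s.re) (hs₁ : s.re < 1) :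
    D.xi s = conj (D.xi (1 - conj s)) :=
  D.functional_equation s hs₀ hs₁

/-- The Fourier transform of `ξ^F` on the critical line,
`Φ_F(u) = (1/2π) ∫_ℝ ξ^F((1+ix)/2) e^{−ixu} dx` (eq. defining `Φ_F`, p. 5); a Bochner integral
(`= 0` if divergent; it converges for every datum with `k ≥ 1`, proof of Thm. 1, p. 6). [cite: Dobner2021, §2 p. 5 (definition of Φ_F)] -/
def Phi (u : ℝ) : ℂ :=
  (1 / (2 * Real.pi) : ℂ) * ∫ x : ℝ, D.xi ((1 + I * x) / 2) * Complex.exp (-(I * x * u))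

/-- The deformed family in the rotated variable:
`H_t(z) = ξ^F_t((1+iz)/2) = ∫_ℝ e^{tu²} Φ_F(u) e^{izu} du` (p. 5, definition of `ξ^F_t`; p. 6,
`H_t`), written with the tree's trigonometric integral
`Literature.Analysis.Complex.trigIntegral K z = ∫ K(u) e^{izu} du` of the kernel
`K(u) = e^{tu²} Φ_F(u)`. [cite: Dobner2021, §2 pp. 5–6 (ξ^F_t and H_t)] -/
def Ht (t : ℝ) (z : ℂ) : ℂ :=
  Literature.Analysis.Complex.trigIntegral (fun u : ℝ ↦ ((Real.exp (t * u ^ 2) : ℝ) : ℂ) * D.Phi u) z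

/-- The deformation `ξ^F_t(s) = H_t(−i(2s − 1))` of `ξ^F` ("the functions `ξ^F_t` … are simply the
un-rotated versions of `H_t`", p. 6; `s = (1+iz)/2 ↔ z = −i(2s−1)`, the same change of variable
as the tree's `xiDeformed`). [cite: Dobner2021, §2 pp. 5–6] -/
def xiDeformed (t : ℝ) (s : ℂ) : ℂ :=
  D.Ht t (-I * (2 * s - 1))

/-- The set `𝒵 = {t ∈ ℝ : all the roots of H_t are real}` (proof of Thm. 1, p. 6). [cite: Dobner2021, §2 p. 6 (the set 𝒵)] -/
def realZeroTimes : Set ℝ :=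
  {t : ℝ | HasOnlyRealZeros (D.Ht t)}

/-- The generalized de Bruijn–Newman constant `Λ_F = inf 𝒵` of the datum ("the unique real
number for which `ξ^F_t` has all of its zeros on the critical line if and only if `t ≥ Λ_F`",
p. 7). As a bare `sInf` it is meaningful through `dobner_theorem1` (`𝒵 = [Λ_F, ∞)`). [cite: Dobner2021, Thm. 1 and §2 p. 7] -/
def dbnConst : ℝ :=
  sInf D.realZeroTimes

/-- `t ∈ 𝒵 ↔ H_t` has only real zeros (definition of `𝒵`, p. 6). [cite: Dobner2021, §2 p. 6 (the set 𝒵)] -/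
theorem mem_realZeroTimes_iff (t : ℝ) : t ∈ D.realZeroTimes ↔ HasOnlyRealZeros (D.Ht t) :=
  Iff.rfl

/-- "`𝒵` could just as well be defined as the set of `t` for which all the zeros of `ξ^F_t` lie on
the critical line" (p. 6): `H_t` has only real zeros iff every zero of `ξ^F_t` has real part
`½`. [cite: Dobner2021, §2 p. 6] -/
theorem hasOnlyRealZeros_Ht_iff (t : ℝ) :
    HasOnlyRealZeros (D.Ht t) ↔ ∀ s : ℂ, D.xiDeformed t s = 0 → s.re = 1 / 2 := by
  constructor
  · intro h s hs
    have him := h _ hs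
    rw [im_neg_I_mul] at him
    linarith
  · intro h z hz
    have hs : D.xiDeformed t ((1 + I * z) / 2) = 0 := by
      rw [xiDeformed]
      have : -I * (2 * ((1 + I * z) / 2) - 1) = z := by
        rw [show 2 * ((1 + I * z) / 2) - 1 = I * z by ring, ← mul_assoc, show -I * I = 1 by
          rw [neg_mul, Complex.I_mul_I, neg_neg], one_mul]
      rw [this]
      exact hz
    have hre := h _ hs
    have : ((1 + I * z) / 2).re = (1 - z.im) / 2 := by
      simp [Complex.add_re, Complex.mul_re, sub_eq_add_neg]
    rw [this] at hre
    linarith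

/-- From (i): the coefficients satisfy `aₙ = O(n²)` ("from (i) it is clear that `|aₙ|` cannot grow
too fast … say, `aₙ = O(n²)`", p. 5) — absolute convergence at `s = 2` forces `aₙ n⁻² → 0`. [cite: Dobner2021, §2 p. 5] -/
theorem coeff_isBigO_sq : D.coeff =O[atTop] fun n : ℕ ↦ (n : ℝ) ^ 2 := by
  have hs : LSeriesSummable D.coeff 2 := D.summable 2 (by norm_num)
  have h0 : Tendsto (LSeries.term D.coeff 2) atTop (nhds 0) := Summable.tendsto_atTop_zero hs
  have h1 : LSeries.term D.coeff 2 =O[atTop] fun _ : ℕ ↦ (1 : ℝ) := h0.isBigO_one ℝ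
  have h3 : (fun n : ℕ ↦ (n : ℂ) ^ 2) =O[atTop] fun n : ℕ ↦ (n : ℝ) ^ 2 :=
    IsBigO.of_bound 1 (Eventually.of_forall fun n ↦ by simp)
  have h2 : ∀ᶠ n : ℕ in atTop, LSeries.term D.coeff 2 n * (n : ℂ) ^ 2 = D.coeff n := by
    filter_upwards [eventually_ne_atTop 0] with n hn
    rw [LSeries.term_of_ne_zero hn, Complex.cpow_two, div_mul_cancel₀]
    exact pow_ne_zero _ (Nat.cast_ne_zero.2 hn)
  exact (h1.mul h3).congr' h2 (Eventually.of_forall fun n ↦ one_mul _)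

end ExtendedSelbergDatum

/-! ## Named facts: Dobner's Theorem 1, Theorem 2, Lemma 1, Lemma 2 -/

/-- NAMED FACT (**Dobner 2021, Thm. 1**, p. 3: "For every `F ∈ 𝒮♯`, there is a real number `Λ_F`
such that all the zeros of `ξ^F_t` lie on the critical line if and only if `t ≥ Λ_F`"; proof
pp. 6–7: `Φ_F` has conjugate symmetry and decay `≪ e^{−e^{2δu}/(3Q^δ)}` (Lemma 2), so de Bruijn's
Thm. 13 = `Literature.Analysis.Complex.DeBruijn1950.thm13` applies; `𝒵` is closed (Hurwitz),
upward closed (de Bruijn), nonempty (zero-free half-plane of `F`), and `≠ ℝ` by Thm. 2).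
Rendered per datum `D` (zeros on the critical line ↔ real zeros of `H_t`,
`ExtendedSelbergDatum.hasOnlyRealZeros_Ht_iff`) and under the tacit printed hypothesis `k ≥ 1`
(module docstring, item 3). Users take `(h : dobner_theorem1)`. [cite: Dobner2021, Thm. 1] -/
def dobner_theorem1 : Prop :=
  ∀ D : ExtendedSelbergDatum, 0 < D.numGamma →
    ∃ Λ : ℝ, ∀ t : ℝ, HasOnlyRealZeros (D.Ht t) ↔ Λ ≤ t

/-- NAMED FACT (**Dobner 2021, Thm. 2**, p. 3: "`Λ_F ≥ 0` for every `F ∈ 𝒮♯`"), typed as the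
statement §3 proves (p. 8, first sentence: "To prove `Λ_F ≥ 0`, we will take a direct approach by
showing that for every `t < 0` the function `ξ^F_t` has zeros off the critical line"): for every
datum with `k ≥ 1` and every `t < 0`, `H_t` has a non-real zero. The literal `Λ_F ≥ 0` is
`ExtendedSelbergDatum.dbnConst_nonneg` below. The case `F = ζ` (`Λ ≥ 0`, Rodgers–Tao 2020) is
the tree THEOREM `Literature.NumberTheory.LFunctions.rodgers_tao_holds` (via Dobner's own proof,
`DobnerLemma4Proofs.lean`); the `𝒮♯`-generality (Thm. 4 with general `Q, ωᵢ`, Bohr's theorem,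
Lemma 3, Rouché/Hurwitz) is not formalised. Users take `(h : dobner_theorem2)`. [cite: Dobner2021, Thm. 2] -/
def dobner_theorem2 : Prop :=
  ∀ D : ExtendedSelbergDatum, 0 < D.numGamma → ∀ t : ℝ, t < 0 → ¬ HasOnlyRealZeros (D.Ht t)

/-- NAMED FACT (**Dobner 2021, Lemma 1**, p. 5, proof p. 15: "Let `γ(s)` be one of the functions
described in condition (iii) … Let `D > 0` and `0 ≤ θ < 1` and let `s` be … at least unit distance
away from the poles of `γ`, and … `|Re s| ≤ D|Im s|^θ`. There exist `K, K' > 0` (depending on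
`γ, D, θ`) such that `exp(−K'|Im s|) ≤ |γ(s)| ≤ exp(−K|Im s|)`"). Typed range: `|Im s| ≥ T₀` with
`T₀` depending on `γ, D, θ` (the range the proof treats; for `|Im s|` large the unit-distance
condition is automatic) and `k ≥ 1`; divergence: the printed all-`s` form without implied
constants is false for bounded `Im s` (module docstring, items 3–4). Proof in the source:
Stirling's formula for each `Γ(ωᵢ s + μᵢ)`, `|Γ(z)| = exp(−(Im z) Arg z + O(|Im z|^{θ'}))`.
Users take `(h : dobner_lemma1)`. [cite: Dobner2021, Lemma 1] -/
def dobner_lemma1 : Prop :=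
  ∀ (α : ℂ) (m : ℕ) (Q : ℝ) (k : ℕ) (ω : Fin k → ℝ) (μ : Fin k → ℂ),
    α ≠ 0 → 0 < Q → 0 < k → (∀ i, 0 < ω i) → (∀ i, 0 ≤ (μ i).re) →
    ∀ (D θ : ℝ), 0 < D → 0 ≤ θ → θ < 1 →
      ∃ K K' T₀ : ℝ, 0 < K ∧ 0 < K' ∧ ∀ s : ℂ, |s.re| ≤ D * |s.im| ^ θ → T₀ ≤ |s.im| →
        Real.exp (-(K' * |s.im|)) ≤ ‖dobnerGamma α m Q ω μ s‖ ∧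
          ‖dobnerGamma α m Q ω μ s‖ ≤ Real.exp (-(K * |s.im|))

/-- NAMED FACT (**Dobner 2021, Lemma 2**, p. 6, proof pp. 15–16: "Let
`h(x) = (1/2πi) ∫_{1−i∞}^{1+i∞} ∏_{j=1}^{k} Γ(aⱼ w + bⱼ) x^{−w} dw` for some `aⱼ > 0` and
`bⱼ ∈ ℂ` with `Re bⱼ ≥ 0`. Then there exists a `δ > 0` (depending on the `aⱼ` and `bⱼ`) such that
`h(x) ≪ e^{−x^δ}` for all `x ≥ 1`"). Here `h = mellinInv 1 (∏ⱼ Γ(aⱼ · + bⱼ))`, Mathlib's inverse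
Mellin transform `mellinInv σ f x = (1/2π) ∫ x^{−(σ+iy)} f(σ+iy) dy` along `Re w = 1`, and `≪` is
an explicit constant `C`; `k ≥ 1` explicit (module docstring, item 3). Proof in the source: the
class `𝓡` of continuous functions with `f ≪ e^{−x^δ}` (`x ≥ 1`) and `f ≪_κ x^{−κ}` is closed
under multiplicative convolution, and the inverse Mellin transform of `Γ(aw + b)` is
`a⁻¹ x^{b/a} e^{−x^{1/a}} ∈ 𝓡`. Users take `(h : dobner_lemma2)`. [cite: Dobner2021, Lemma 2] -/
def dobner_lemma2 : Prop :=
  ∀ (k : ℕ) (a : Fin k → ℝ) (b : Fin k → ℂ), 0 < k → (∀ j, 0 < a j) → (∀ j, 0 ≤ (b j).re) →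
    ∃ δ C : ℝ, 0 < δ ∧ ∀ x : ℝ, 1 ≤ x →
      ‖mellinInv 1 (fun w : ℂ ↦ ∏ j, Complex.Gamma ((a j : ℂ) * w + b j)) x‖ ≤
        C * Real.exp (-(x ^ δ))

/-! ## The literal forms of Theorems 1 and 2 in terms of `Λ_F = D.dbnConst` -/

namespace ExtendedSelbergDatum

variable (D : ExtendedSelbergDatum)

/-- Under Thm. 1: `𝒵 = [Λ_F, ∞)` ("`𝒵 = {t ≥ Λ_F}`", p. 7). [cite: Dobner2021, Thm. 1 (proof, p. 7)] -/
theorem realZeroTimes_eq_Ici (h₁ : dobner_theorem1) (hk : 0 < D.numGamma) :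
    D.realZeroTimes = Set.Ici D.dbnConst := by
  obtain ⟨Λ, hΛ⟩ := h₁ D hk
  have hZ : D.realZeroTimes = Set.Ici Λ := Set.ext fun t ↦ hΛ t
  have hc : D.dbnConst = Λ := by rw [dbnConst, hZ, csInf_Ici]
  rw [hc, hZ]

/-- Thm. 1 in its printed form for the constant `Λ_F = D.dbnConst`: all zeros of `ξ^F_t` lie on
the critical line (equivalently `H_t` has only real zeros) iff `t ≥ Λ_F`. [cite: Dobner2021, Thm. 1] -/
theorem hasOnlyRealZeros_Ht_iff_dbnConst_le (h₁ : dobner_theorem1) (hk : 0 < D.numGamma)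
    (t : ℝ) : HasOnlyRealZeros (D.Ht t) ↔ D.dbnConst ≤ t := by
  rw [← mem_realZeroTimes_iff, D.realZeroTimes_eq_Ici h₁ hk, Set.mem_Ici]

/-- Thm. 2 in its printed form: `Λ_F ≥ 0` (from the `sInf`-free fact `dobner_theorem2` and
Thm. 1). [cite: Dobner2021, Thm. 2] -/
theorem dbnConst_nonneg (h₁ : dobner_theorem1) (h₂ : dobner_theorem2) (hk : 0 < D.numGamma) :
    0 ≤ D.dbnConst := by
  by_contra hlt
  push Not at hlt
  exact h₂ D hk _ hlt ((D.hasOnlyRealZeros_Ht_iff_dbnConst_le h₁ hk _).2 le_rfl)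

end ExtendedSelbergDatum

end Literature.NumberTheory.LFunctions

end
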